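import Summits.ValiantsHypothesis.ValiantsHypothesis.Theorems.DepthWindowSparseTwoLevelFix
import Summits.ValiantsHypothesis.ValiantsHypothesis.Theorems.DepthWindowPathWeights
import HarnessLib

/-!
# Route `DepthWindow`, g8 — the two-level jump formula restricted to good outer indices

Last algebraic preparation for piece (iv) of the `(2,3)` SLIVER LEMMA (lens-4 NODE-v8 §11–§12).
The generic gate builder `exists_append_sumProdSumProdMul` asks that the block weights of EVERY outer
index add up to the same total `E`; in the fixed-endpoint two-level jump formula
(`weightedHomogeneousComponent_prod_eq_twoLevel_fix`) this holds — with `E = e` — exactly for the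
GOOD outer indices `α = (κ, y, S)`: terminal degree `y₁ = e` and outer path `S` stepwise monotone
in the degree coordinate.  All other summands vanish (`finVec y = 0` if `y₁ ≠ e`; a
block with decreasing degree has inner path sum `0`, `sum_pathsFix_pathWeight_eq_zero`), so the
formula may be restricted to the good indices (`weightedHomogeneousComponent_prod_eq_twoLevel_good`),
and on those the block weights telescope to `e` (`sum_blockWt_eq_of_good`).
Pure algebra; nothing here bears on `VP ≠ VNP`.

[cite: LimayeSrinivasanTavenas2025, Lemma 11] [cite: Burgisser2000, Def. 2.1]
-/

set_option linter.dupNamespace false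

namespace Summit.ValiantsHypothesis.ValiantsHypothesis.Theorems.DepthWindow

open Finset MvPolynomial

variable {σ R : Type*} [CommRing R]

/-- A path whose degree coordinate ends below where it starts has a decreasing step. -/
theorem exists_step_lt_of_lt {d t b : ℕ} (s : Fin (b + 1) → Fin (d + 1) × Fin (t + 1))
    (h : ((s (Fin.last b)).1 : ℕ) < (s 0).1) :
    ∃ u : Fin b, ((s u.succ).1 : ℕ) < (s u.castSucc).1 := by
  by_contra hne
  simp only [not_exists, not_lt] at hne
  have hmono : Monotone (fun u : Fin (b + 1) => ((s u).1 : ℕ)) := Fin.monotone_iff_le_succ.mpr hne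
  have := hmono (Fin.zero_le (Fin.last b))
  simp only at this
  omega

/-- A path product through the padded jump layers with a decreasing degree step vanishes. -/
theorem pathWeight_padLayers_eq_zero_of_step_lt (w : σ → ℕ) (d t : ℕ) (U : ℕ → MvPolynomial σ R)
    (κ a b : ℕ) (q : Fin a) (s : Fin (b + 1) → Fin (d + 1) × Fin (t + 1))
    (u : Fin b) (hu : ((s u.succ).1 : ℕ) < (s u.castSucc).1) :
    pathWeight (fun u : Fin b =>
      padLayers (jumpMat w d t U) κ (a * b) ⟨(q : ℕ) * b + u, blockIndex_lt q u⟩) s = 0 := by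
  unfold pathWeight
  exact Finset.prod_eq_zero (Finset.mem_univ u)
    (padLayers_jumpMat_eq_zero_of_lt w d t U κ (a * b) _ _ _ hu)

/-- **Blocks with decreasing degree vanish**: the inner path sum of a block from `x` to `y` with
`y₁ < x₁` is `0`. -/
theorem sum_pathsFix_pathWeight_eq_zero (w : σ → ℕ) (d t : ℕ) (U : ℕ → MvPolynomial σ R)
    (κ a b : ℕ) (q : Fin a) (x y : Fin (d + 1) × Fin (t + 1)) (hxy : (y.1 : ℕ) < x.1) :
    ∑ s : PathsFix (Fin (d + 1) × Fin (t + 1)) b x y,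
      pathWeight (fun u : Fin b =>
        padLayers (jumpMat w d t U) κ (a * b) ⟨(q : ℕ) * b + u, blockIndex_lt q u⟩) s.1 = 0 := by
  refine Finset.sum_eq_zero fun s _ => ?_
  have hlt : ((s.1 (Fin.last b)).1 : ℕ) < (s.1 0).1 := by
    rw [s.2.1, s.2.2]; exact hxy
  obtain ⟨u, hu⟩ := exists_step_lt_of_lt s.1 hlt
  exact pathWeight_padLayers_eq_zero_of_step_lt w d t U κ a b q s.1 u hu

/-- **On good indices the block weights telescope to `e`** (good = terminal degree `e` and
stepwise monotone degree along the outer path). -/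
theorem sum_blockWt_eq_of_good {d t a : ℕ} (e : ℕ)
    (α : Fin (e + 1) × ((y : Fin (d + 1) × Fin (t + 1)) ×
      PathsFix (Fin (d + 1) × Fin (t + 1)) a ((0 : Fin (d + 1)), (0 : Fin (t + 1))) y))
    (hy : (α.2.1.1 : ℕ) = e) (hS : ∀ q : Fin a, ((α.2.2.1 q.castSucc).1 : ℕ) ≤ (α.2.2.1 q.succ).1) :
    ∑ q : Fin a, (((α.2.2.1 q.succ).1 : ℕ) - (α.2.2.1 q.castSucc).1) = e := by
  rw [sum_steps_eq_of_stepMono a (fun q => ((α.2.2.1 q).1 : ℕ)) hS]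
  show ((α.2.2.1 (Fin.last a)).1 : ℕ) - ((α.2.2.1 0).1 : ℕ) = e
  rw [α.2.2.2.2, α.2.2.2.1, hy]
  simp

/-- **The two-level jump formula restricted to good outer indices.**
[cite: LimayeSrinivasanTavenas2025, Lemma 11] -/
theorem weightedHomogeneousComponent_prod_eq_twoLevel_good (w : σ → ℕ) (d t e a b : ℕ)
    (he : e ≤ d) (hab : e ≤ a * b) (U : ℕ → MvPolynomial σ R) :
    weightedHomogeneousComponent w e (∏ l ∈ range t, U l) =
      ∑ α ∈ (Finset.univ : Finset (Fin (e + 1) × ((y : Fin (d + 1) × Fin (t + 1)) ×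
              PathsFix (Fin (d + 1) × Fin (t + 1)) a ((0 : Fin (d + 1)), (0 : Fin (t + 1))) y))).filter
            (fun α => ((α.2.1.1 : ℕ) = e) ∧
              ∀ q : Fin a, ((α.2.2.1 q.castSucc).1 : ℕ) ≤ (α.2.2.1 q.succ).1),
        finVec w d t e U α.2.1 *
          ∏ q : Fin a, ∑ s : PathsFix (Fin (d + 1) × Fin (t + 1)) b (α.2.2.1 q.castSucc) (α.2.2.1 q.succ),
            pathWeight (fun u : Fin b =>
              padLayers (jumpMat w d t U) (α.1 : ℕ) (a * b) ⟨(q : ℕ) * b + u, blockIndex_lt q u⟩) s.1 := by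
  rw [weightedHomogeneousComponent_prod_eq_twoLevel_fix w d t e a b he hab U]
  symm
  refine Finset.sum_subset (Finset.filter_subset _ _) fun α _ hα => ?_
  rw [Finset.mem_filter, not_and] at hα
  have hα' := hα (Finset.mem_univ α)
  rw [not_and_or] at hα'
  rcases hα' with hy | hS
  · have hfin : finVec w d t e U α.2.1 = 0 := by
      unfold finVec; rw [if_neg hy]
    rw [hfin, zero_mul]
  · simp only [not_forall, not_le] at hS
    obtain ⟨q, hq⟩ := hS
    rw [Finset.prod_eq_zero (Finset.mem_univ q)
      (sum_pathsFix_pathWeight_eq_zero w d t U _ a b q _ _ hq), mul_zero]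

end Summit.ValiantsHypothesis.ValiantsHypothesis.Theorems.DepthWindow
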